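import Literature.Analysis.FluidPDE.PassiveScalarWellPosednessProofs
import Literature.Analysis.FluidPDE.TsaiMaximumPrinciple
import HarnessLib

/-!
# The weak maximum principle for classical advection–diffusion on the torus

Analysis/FluidPDE proof-support file (everything proved). For a classical solution `θ` of the
passive scalar equation `∂ₜθ + u·∇θ = κΔθ` on `[0,T] × T^d` (`Torus.IsClassicalScalarTransportOn
(Icc 0 T) κ u θ`, jointly smooth, one-sided time derivatives) with `κ ≥ 0`:

* `IsClassicalScalarTransportOn.nonneg_of_nonneg` — `θ(0) ≥ 0 ⇒ θ(t) ≥ 0` on `[0,T]`;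
* `IsClassicalScalarTransportOn.le_of_le`, `IsClassicalScalarTransportOn.ge_of_ge` — upper and
  lower bounds of the datum propagate;
* `IsClassicalScalarTransportOn.abs_sub_le` — the sup-norm contraction
  `sup |θ₁(t) - θ₂(t)| ≤ sup |θ₁(0) - θ₂(0)|` for two solutions with the same drift.

Proof (Evans 2010, §7.1.4, Thm. 8 (weak maximum principle for parabolic operators, `c = 0`),
specialised to the compact manifold `T^d`, where there is no lateral boundary): for `ε > 0` the
function `v = θ + ε(1 + t)` is `≥ ε > 0` at `t = 0`; if it were `≤ 0` somewhere, take the first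
time `t⋆ > 0` at which `{v ≤ 0}` is reached (compactness of `[0,T] × T^d`) and a spatial minimum
`x⋆` of `θ(t⋆)`; there `∇θ = 0`, `Δθ ≥ 0` (second-order condition, the tree's
`laplacian_nonpos_of_isLocalMax`) and the left time derivative of `v(·, x⋆)` is `≤ 0` (first-order
condition within `[0, t⋆]`), contradicting `∂ₜv = κΔθ - u·∇θ + ε ≥ ε`.

## References

* L. C. Evans, *Partial Differential Equations*, 2nd ed., AMS (2010), §7.1.4, Thm. 8; §2.3.3.
  [`Evans2010`]
* D. Gilbarg, N. S. Trudinger, *Elliptic Partial Differential Equations of Second Order*,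
  Springer (2001), §3.1. [`GilbargTrudinger2001`]
-/

noncomputable section

open MeasureTheory Set Filter Topology Function
open scoped InnerProductSpace Laplacian ContDiff
open Literature.Analysis.FunctionSpaces Literature.Analysis.FunctionSpaces.Torus

namespace Literature.Analysis.FluidPDE

namespace Torus

variable {d : Type*} [Fintype d] [DecidableEq d]

/-! ## First- and second-order conditions at a spatial minimum -/

omit [DecidableEq d] in
/-- At a global minimum of a smooth scalar on `T^d` the gradient vanishes. [folklore] -/
theorem gradient_eq_zero_of_isMinOn {g : UnitAddTorus d → ℝ} (hg : IsSmooth g) {x : UnitAddTorus d}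
    (hmin : ∀ y, g x ≤ g y) : FunctionSpaces.Torus.gradient g x = 0 := by
  have hloc : IsLocalMin (liftAt g x) 0 :=
    Filter.Eventually.of_forall fun v => by
      rw [liftAt_apply, liftAt_apply, proj_zero, add_zero]; exact hmin _
  have _ := hg
  rw [FunctionSpaces.Torus.gradient, _root_.gradient, hloc.fderiv_eq_zero]
  exact (InnerProductSpace.toDual ℝ (EuclideanSpace ℝ d)).symm.map_zero

omit [DecidableEq d] in
/-- At a global minimum of a smooth scalar on `T^d` the Laplacian is nonnegative (second-order
condition; Gilbarg–Trudinger 2001, §3.1). [cite: GilbargTrudinger2001, §3.1] -/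
theorem laplacian_nonneg_of_isMinOn {g : UnitAddTorus d → ℝ} (hg : IsSmooth g) {x : UnitAddTorus d}
    (hmin : ∀ y, g x ≤ g y) : 0 ≤ FunctionSpaces.Torus.laplacian g x := by
  have hV : ContDiff ℝ 2 (liftAt g x) := (hg.liftAt x).of_le (by norm_cast)
  have hmax : IsLocalMax (-liftAt g x) 0 :=
    Filter.Eventually.of_forall fun v => by
      simpa only [Pi.neg_apply, neg_le_neg_iff, liftAt_apply, proj_zero, add_zero] using hmin (x + proj v)
  have h := laplacian_nonpos_of_isLocalMax (V := -liftAt g x) hV.neg hmax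
  rw [InnerProductSpace.laplacian_neg, Pi.neg_apply, neg_nonpos] at h
  exact h

/-! ## The left time derivative at a first touching time -/

omit [Fintype d] [DecidableEq d] in
/-- If `f > f(t⋆)` on `[0, t⋆)` with `t⋆ > 0` and `f` has derivative `D` within `[0, t⋆]` at `t⋆`,
then `D ≤ 0` (first-order condition at a boundary minimum). [folklore] -/
theorem deriv_nonpos_of_isMinOn_left {f : ℝ → ℝ} {D tstar : ℝ} (ht : 0 < tstar)
    (hf : HasDerivWithinAt f D (Icc 0 tstar) tstar) (hmin : ∀ s ∈ Icc 0 tstar, f tstar ≤ f s) :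
    D ≤ 0 := by
  have hmin' : IsMinOn f (Icc 0 tstar) tstar := fun s hs => hmin s hs
  have hloc : IsLocalMinOn f (Icc 0 tstar) tstar := hmin'.localize
  have hy : (-tstar : ℝ) ∈ posTangentConeAt (Icc 0 tstar) tstar := by
    refine mem_posTangentConeAt_of_segment_subset ?_
    rw [add_neg_cancel]
    exact (convex_Icc 0 tstar).segment_subset (right_mem_Icc.2 ht.le) (left_mem_Icc.2 ht.le)
  have h := hloc.hasFDerivWithinAt_nonneg hf.hasFDerivWithinAt hy
  rw [ContinuousLinearMap.toSpanSingleton_apply, smul_eq_mul] at h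
  nlinarith

namespace IsClassicalScalarTransportOn

variable {κ T : ℝ} {u : ℝ → UnitAddTorus d → EuclideanSpace ℝ d} {θ : ℝ → UnitAddTorus d → ℝ}

/-- **Weak maximum principle** (Evans 2010, §7.1.4, Thm. 8 on the torus): a classical solution of
`∂ₜθ + u·∇θ = κΔθ`, `κ ≥ 0`, on `[0,T] × T^d` with nonnegative datum stays nonnegative.
[cite: Evans2010, §7.1.4 Thm. 8] -/
theorem nonneg_of_nonneg (hκ : 0 ≤ κ) (h : IsClassicalScalarTransportOn (Icc 0 T) κ u θ)
    (h0 : ∀ x, 0 ≤ θ 0 x) : ∀ t ∈ Icc 0 T, ∀ x, 0 ≤ θ t x := by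
  by_contra! hneg
  obtain ⟨t₁, ht₁, x₁, hx₁⟩ := hneg
  -- the perturbation `v = θ + ε (1 + t)`
  set ε : ℝ := -θ t₁ x₁ / (2 * (1 + T)) with hε
  have hT : 0 ≤ T := ht₁.1.trans ht₁.2
  have hε0 : 0 < ε := div_pos (neg_pos.2 hx₁) (by positivity)
  -- the compact fundamental domain and the touching set
  set K : Set (EuclideanSpace ℝ d) := (WithLp.toLp 2) '' (Set.pi univ fun _ : d => Icc (0 : ℝ) 1) with hK
  have hKc : IsCompact K := isCompact_toLp_image_pi_Icc
  set G : ℝ × EuclideanSpace ℝ d → ℝ := fun p => stLift θ p + ε * (1 + p.1) with hG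
  have hGc : ContinuousOn G (Icc 0 T ×ˢ K) :=
    ((h.smooth_scalar.continuousOn_stLift).mono (prod_mono le_rfl (subset_univ _))).add
      (continuous_const.mul (continuous_const.add continuous_fst)).continuousOn
  set Z : Set (ℝ × EuclideanSpace ℝ d) := (Icc 0 T ×ˢ K) ∩ G ⁻¹' (Iic 0) with hZ
  have hZc : IsCompact Z :=
    (isCompact_Icc.prod hKc).of_isClosed_subset
      (hGc.preimage_isClosed_of_isClosed (isClosed_Icc.prod hKc.isClosed) isClosed_Iic) inter_subset_left
  have hGval : ∀ (t : ℝ) (x : UnitAddTorus d), G (t, repr x) = θ t x + ε * (1 + t) := fun t x => by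
    simp only [hG, stLift_apply, proj_repr]
  have hZne : Z.Nonempty := by
    refine ⟨(t₁, repr x₁), ⟨ht₁, repr_mem_toLp_image_pi_Icc x₁⟩, ?_⟩
    show G (t₁, repr x₁) ≤ 0
    rw [hGval]
    have h1 : ε * (1 + t₁) ≤ ε * (1 + T) := mul_le_mul_of_nonneg_left (by linarith [ht₁.2]) hε0.le
    have h2 : ε * (2 * (1 + T)) = -θ t₁ x₁ := by rw [hε]; field_simp
    nlinarith
  -- the first touching time `t⋆` and a spatial minimum `x⋆` of `θ(t⋆)`
  obtain ⟨tstar, ⟨pstar, hpZ, hpt⟩, hleast⟩ := (hZc.image continuous_fst).exists_isLeast (hZne.image _)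
  have htI : tstar ∈ Icc 0 T := hpt ▸ hpZ.1.1
  have hθc : Continuous (θ tstar) := (h.smooth_scalar.isSmooth_slice htI).continuous
  obtain ⟨xstar, -, hxmin⟩ := isCompact_univ.exists_isMinOn univ_nonempty hθc.continuousOn
  have hxmin' : ∀ y, θ tstar xstar ≤ θ tstar y := fun y => hxmin (mem_univ y)
  -- `v(t⋆, x⋆) ≤ 0`
  have hvstar : θ tstar xstar + ε * (1 + tstar) ≤ 0 := by
    have h1 : G pstar ≤ 0 := hpZ.2
    have h2 : G pstar = θ tstar (proj pstar.2) + ε * (1 + tstar) := by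
      rw [← hpt]; rfl
    rw [h2] at h1
    linarith [hxmin' (proj pstar.2)]
  -- `t⋆ > 0`
  have ht0 : 0 < tstar := by
    rcases htI.1.eq_or_lt with h0' | h0'
    · exfalso
      have := h0 xstar
      rw [← h0'] at hvstar
      linarith
    · exact h0'
  -- before `t⋆` the perturbed field is positive
  have hpos : ∀ s ∈ Ico 0 tstar, ∀ x, 0 < θ s x + ε * (1 + s) := by
    intro s hs x
    by_contra! hle
    have hsZ : (s, repr x) ∈ Z :=
      ⟨⟨⟨hs.1, hs.2.le.trans htI.2⟩, repr_mem_toLp_image_pi_Icc x⟩, by show G (s, repr x) ≤ 0; rwa [hGval]⟩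
    have := hleast ⟨(s, repr x), hsZ, rfl⟩
    exact absurd hs.2 (not_lt.2 this)
  -- the left time derivative of `v(·, x⋆)` at `t⋆` is `≤ 0`
  set D : ℝ := timeDerivWithin (Icc 0 T) θ tstar xstar + ε with hD
  have hderiv : HasDerivWithinAt (fun s => θ s xstar + ε * (1 + s)) D (Icc 0 T) tstar := by
    have h1 := h.smooth_scalar.hasDerivWithinAt_slice htI xstar
    have h2 : HasDerivWithinAt (fun s : ℝ => ε * (1 + s)) (ε * 1) (Icc 0 T) tstar :=
      ((hasDerivWithinAt_id tstar (Icc 0 T)).const_add 1).const_mul ε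
    have h3 := h1.add h2
    rw [mul_one] at h3
    exact h3
  have hDle : D ≤ 0 := by
    refine deriv_nonpos_of_isMinOn_left ht0 (hderiv.mono (Icc_subset_Icc_right htI.2)) fun s hs => ?_
    rcases hs.2.eq_or_lt with rfl | hlt
    · exact le_rfl
    · exact hvstar.trans (hpos s ⟨hs.1, hlt⟩ xstar).le
  -- but the equation gives `D ≥ ε`
  have hsl : IsSmooth (θ tstar) := h.smooth_scalar.isSmooth_slice htI
  have heq := h.transport tstar htI xstar
  rw [gradient_eq_zero_of_isMinOn hsl hxmin', inner_zero_right, add_zero] at heq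
  have hlap := laplacian_nonneg_of_isMinOn hsl hxmin'
  have hDge : ε ≤ D := by
    rw [hD, heq]
    nlinarith [mul_nonneg hκ hlap]
  linarith

/-! ## Constants and reflected solutions -/

omit [DecidableEq d] in
/-- The gradient of a constant vanishes. [folklore] -/
theorem _root_.Literature.Analysis.FluidPDE.Torus.gradient_const' (c : ℝ) (z : UnitAddTorus d) :
    FunctionSpaces.Torus.gradient (fun _ : UnitAddTorus d => c) z = 0 := by
  show _root_.gradient (liftAt (fun _ : UnitAddTorus d => c) z) 0 = 0
  have e : liftAt (fun _ : UnitAddTorus d => c) z = fun _ => c := rfl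
  rw [e]
  simp [_root_.gradient]

omit [DecidableEq d] in
/-- The Laplacian of a constant vanishes. [folklore] -/
theorem _root_.Literature.Analysis.FluidPDE.Torus.laplacian_const' (c : ℝ) (z : UnitAddTorus d) :
    FunctionSpaces.Torus.laplacian (fun _ : UnitAddTorus d => c) z = 0 := by
  have h := congrFun (InnerProductSpace.laplacian_eq_iteratedFDeriv_orthonormalBasis
    (liftAt (fun _ : UnitAddTorus d => c) z) (EuclideanSpace.basisFun d ℝ)) 0
  rw [FunctionSpaces.Torus.laplacian, h]
  have e : liftAt (fun _ : UnitAddTorus d => c) z = fun _ => c := rfl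
  simp [e, iteratedFDeriv_const_of_ne two_ne_zero]

/-- Constants are classical solutions (for a smooth divergence-free drift). [folklore] -/
theorem const {S : Set ℝ} (hu : IsSmoothSpaceTimeOn S u) (hdiv : ∀ t ∈ S, IsDivFree (u t)) (c : ℝ) :
    IsClassicalScalarTransportOn S κ u (fun _ _ => c) where
  smooth_velocity := hu
  smooth_scalar := isSmoothSpaceTimeOn_const (isSmooth_const c) S
  transport t _ x := by
    have h1 : timeDerivWithin S (fun (_ : ℝ) (_ : UnitAddTorus d) => c) t x = 0 := by
      simp [timeDerivWithin]
    rw [h1, gradient_const', laplacian_const', inner_zero_right, mul_zero, add_zero]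
  divFree := hdiv

/-- `c - θ` is a classical solution along with `θ` (linearity; `T > 0`). [folklore] -/
theorem const_sub (hT : 0 < T) (h : IsClassicalScalarTransportOn (Icc 0 T) κ u θ) (c : ℝ) :
    IsClassicalScalarTransportOn (Icc 0 T) κ u (fun t x => c - θ t x) := by
  have h0 : IsSmoothSpaceTimeOn (Icc 0 T) (0 : ℝ → UnitAddTorus d → ℝ) :=
    isSmoothSpaceTimeOn_const (isSmooth_const (0 : ℝ)) _
  have hc := (isClassicalScalarTransportForcedOn_zero_iff h0).2 (const h.smooth_velocity h.divFree c (κ := κ))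
  have hθ := (isClassicalScalarTransportForcedOn_zero_iff h0).2 h
  exact hc.sub hT hθ

/-- `θ - c` is a classical solution along with `θ` (linearity; `T > 0`). [folklore] -/
theorem sub_const (hT : 0 < T) (h : IsClassicalScalarTransportOn (Icc 0 T) κ u θ) (c : ℝ) :
    IsClassicalScalarTransportOn (Icc 0 T) κ u (fun t x => θ t x - c) := by
  have h0 : IsSmoothSpaceTimeOn (Icc 0 T) (0 : ℝ → UnitAddTorus d → ℝ) :=
    isSmoothSpaceTimeOn_const (isSmooth_const (0 : ℝ)) _
  have hc := (isClassicalScalarTransportForcedOn_zero_iff h0).2 (const h.smooth_velocity h.divFree c (κ := κ))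
  have hθ := (isClassicalScalarTransportForcedOn_zero_iff h0).2 h
  exact hθ.sub hT hc

/-! ## Propagation of bounds and the sup-norm contraction -/

/-- **Upper bounds propagate**: `θ(0) ≤ M ⇒ θ(t) ≤ M` on `[0,T]` (`κ ≥ 0`).
[cite: Evans2010, §7.1.4 Thm. 8] -/
theorem le_of_le (hκ : 0 ≤ κ) (h : IsClassicalScalarTransportOn (Icc 0 T) κ u θ) {M : ℝ}
    (h0 : ∀ x, θ 0 x ≤ M) : ∀ t ∈ Icc 0 T, ∀ x, θ t x ≤ M := by
  intro t ht x
  rcases (le_or_gt T 0) with hT | hT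
  · have : t = 0 := le_antisymm (ht.2.trans hT) ht.1
    subst this
    exact h0 x
  · have h1 := nonneg_of_nonneg hκ (h.const_sub hT M) (fun y => sub_nonneg.2 (h0 y)) t ht x
    exact sub_nonneg.1 h1

/-- **Lower bounds propagate**: `m ≤ θ(0) ⇒ m ≤ θ(t)` on `[0,T]` (`κ ≥ 0`).
[cite: Evans2010, §7.1.4 Thm. 8] -/
theorem ge_of_ge (hκ : 0 ≤ κ) (h : IsClassicalScalarTransportOn (Icc 0 T) κ u θ) {m : ℝ}
    (h0 : ∀ x, m ≤ θ 0 x) : ∀ t ∈ Icc 0 T, ∀ x, m ≤ θ t x := by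
  intro t ht x
  rcases (le_or_gt T 0) with hT | hT
  · have : t = 0 := le_antisymm (ht.2.trans hT) ht.1
    subst this
    exact h0 x
  · have h1 := nonneg_of_nonneg hκ (h.sub_const hT m) (fun y => sub_nonneg.2 (h0 y)) t ht x
    exact sub_nonneg.1 h1

/-- **Sup-norm contraction**: for two classical solutions with the same drift,
`|θ₁(t,x) - θ₂(t,x)| ≤ δ` on `[0,T]` as soon as `|θ₁(0,·) - θ₂(0,·)| ≤ δ` (`κ ≥ 0`; the
difference solves the same linear equation). [cite: Evans2010, §7.1.4 Thm. 8] -/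
theorem abs_sub_le (hκ : 0 ≤ κ) {θ₁ θ₂ : ℝ → UnitAddTorus d → ℝ}
    (h₁ : IsClassicalScalarTransportOn (Icc 0 T) κ u θ₁) (h₂ : IsClassicalScalarTransportOn (Icc 0 T) κ u θ₂)
    {δ : ℝ} (h0 : ∀ x, |θ₁ 0 x - θ₂ 0 x| ≤ δ) : ∀ t ∈ Icc 0 T, ∀ x, |θ₁ t x - θ₂ t x| ≤ δ := by
  intro t ht x
  rcases (le_or_gt T 0) with hT | hT
  · have : t = 0 := le_antisymm (ht.2.trans hT) ht.1
    subst this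
    exact h0 x
  · have h0' : IsSmoothSpaceTimeOn (Icc 0 T) (0 : ℝ → UnitAddTorus d → ℝ) :=
      isSmoothSpaceTimeOn_const (isSmooth_const (0 : ℝ)) _
    have hdiff : IsClassicalScalarTransportOn (Icc 0 T) κ u (fun t x => θ₁ t x - θ₂ t x) :=
      ((isClassicalScalarTransportForcedOn_zero_iff h0').2 h₁).sub hT
        ((isClassicalScalarTransportForcedOn_zero_iff h0').2 h₂)
    have hup := le_of_le hκ hdiff (M := δ) (fun y => (abs_le.1 (h0 y)).2) t ht x
    have hlo := ge_of_ge hκ hdiff (m := -δ) (fun y => (abs_le.1 (h0 y)).1) t ht x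
    exact abs_le.2 ⟨hlo, hup⟩

end IsClassicalScalarTransportOn

end Torus

end Literature.Analysis.FluidPDE
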